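import Summits.NavierStokesRegularity.FluidComputer.DampedTransitionViscous
import Summits.NavierStokesRegularity.FluidComputer.DampedTransitionBeable

/-!
# Tao's delay gate under NON-UNIFORM diagonal damping, part 8: the gate theorem for constant viscous rates

Companion of `DampedTransition{,Quiet,Window,Viscous,Fire,Douse,Beable}.lean` (cell `pub-fluidc`, seat bp1).
HONEST FRAMING (verbatim): low prior, high value-of-information experiment on Tao's machine paradigm; NOT a claim
that NS blows up. Five-mode truncation (5.5) of [Tao2016AveragedNS, §5.5]; nothing is proved about Navier–Stokes.

The corollary of THE DAMPED GATE THEOREM `DampedTransition.firingPhase` (part 7) for the VISCOUS member with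
CONSTANT, NON-UNIFORM per-mode rates `dᵢ ∈ [μ, μ + Δ]` in ORIGINAL time, via the conjugacy of part 4
(`Z(s) = (1 - μs)⁻¹ · Y(T_μ(s))` solves the damped member with rates `Eᵢ(s) = (dᵢ - μ)/(1 - μs) ∈ [0, Δ/(1-2μ)]`
on `s ∈ [0,2]`): `firingPhase_visc` (the full gate for `Z`, spread `Δ/(1 - 2μ) ≤ 1/1000`) and
`firingPhase_visc_output` (pulled back: the physical output `Y₄(T_μ(s)) = (1 - μs)(1 + O(K⁻¹⁰ + Δ))` on the fired
window — the rotor has transferred the energy that the COMMON viscosity `μ` has not yet eaten).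
[cite: Tao2016AveragedNS, Theorem 5.3, §5.5]. No named facts; 0 sorry.
-/

noncomputable section

namespace Summit.NavierStokesRegularity.FluidComputer

open Real Set Filter Topology
open Literature.Analysis.FluidPDE.Tao2016AveragedNS
open ViscousConjugacy (viscTime viscTime_le_viscTime viscTime_nonneg)

namespace DampedTransition

section ViscousGate

variable {K M ε μ Δ : ℝ} {d : Fin 5 → ℝ} {Y : ℝ → Fin 5 → ℝ}

/-- **The viscous gate with constant non-uniform rates (conjugated form).** `0 < μ ≤ 1/4`, `dᵢ ∈ [μ, μ + Δ]`,
`Δ/(1 - 2μ) ≤ 1/1000`; `Y` solves `Ẏ = delayCircuitWith K M ε Y - d * Y` on `[0, T_μ(2)]` from `delayInit`;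
family as in `firingPhase`. Then `Z(s) = (1 - μs)⁻¹Y(T_μ(s))` is a delayed-abrupt-transition gate on `[0,2]`
with `η = Δ/(1 - 2μ)`. [cite: Tao2016AveragedNS, Theorem 5.3, §5.5] -/
theorem firingPhase_visc (hμ : 0 < μ) (hμ4 : μ ≤ 1 / 4) (hd : ∀ i, μ ≤ d i ∧ d i ≤ μ + Δ)
    (hY : ∀ t ∈ Icc 0 (viscTime μ 2), HasDerivAt Y (delayCircuitWith K M ε (Y t) - d * Y t) t)
    (h0 : Y 0 = delayInit)
    (hK : 2 * 20 ^ 42 * (Nat.factorial 42 : ℝ) + 16 ≤ K) (hML : 3000 * Real.log K ≤ M)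
    (hMK : M ≤ K ^ 10) (hε : 0 < ε) (hεle : ε ≤ exp (-(10 * M)) / K ^ 100)
    (hΔ : Δ / (1 - 2 * μ) ≤ 1 / 1000) :
    ∃ tc : ℝ, |tc - Real.sqrt 2| ≤ 24 * Real.log K / M + 20 * (Δ / (1 - 2 * μ)) ∧
      (∀ s ∈ Icc 0 tc,
        |(fun r => (1 - μ * r)⁻¹ • Y (viscTime μ r)) s 0 - 1| ≤ 200 / K ^ 10 + 2 * (Δ / (1 - 2 * μ)) ∧
          ∀ i : Fin 5, i ≠ 0 → |(fun r => (1 - μ * r)⁻¹ • Y (viscTime μ r)) s i| ≤ 200 / K ^ 10) ∧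
      (∀ s ∈ Icc (tc + 888 * Real.log K / M + 1 / Real.sqrt K) 2,
        |(fun r => (1 - μ * r)⁻¹ • Y (viscTime μ r)) s 4 - 1| ≤ 200 / K ^ 10 + 4 * (Δ / (1 - 2 * μ)) ∧
          ∀ i : Fin 5, i ≠ 4 → |(fun r => (1 - μ * r)⁻¹ • Y (viscTime μ r)) s i| ≤ 200 / K ^ 10) := by
  have h2μ : μ * 2 < 1 := by linarith
  have hX : ∀ s ∈ Icc (0:ℝ) 2, HasDerivAt (fun r => (1 - μ * r)⁻¹ • Y (viscTime μ r))
      (delayCircuitWith K M ε ((fun r => (1 - μ * r)⁻¹ • Y (viscTime μ r)) s)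
        - (fun r : ℝ => fun i : Fin 5 => (1 - μ * r)⁻¹ * (d i - μ)) s
          * (fun r => (1 - μ * r)⁻¹ • Y (viscTime μ r)) s) s := by
    intro s hs
    have hμs : μ * s < 1 := by nlinarith [hs.2, hμ]
    have hTs : viscTime μ s ∈ Icc 0 (viscTime μ 2) :=
      ⟨viscTime_nonneg hμ hs.1 hμs, viscTime_le_viscTime hμ hs.2 h2μ⟩
    exact hasDerivAt_conj hμ.ne' hμs (hY _ hTs)
  have hE : ∀ s ∈ Icc (0:ℝ) 2, ∀ i,
      0 ≤ (fun r : ℝ => fun i : Fin 5 => (1 - μ * r)⁻¹ * (d i - μ)) s i ∧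
        (fun r : ℝ => fun i : Fin 5 => (1 - μ * r)⁻¹ * (d i - μ)) s i ≤ Δ / (1 - 2 * μ) :=
    fun s hs i => conjRate_bounds hμ hμ4 hd hs i
  have hZ0 : (fun r => (1 - μ * r)⁻¹ • Y (viscTime μ r)) 0 = delayInit := by rw [conj_zero, h0]
  exact firingPhase hX hE hZ0 hK hML hMK hε hεle hΔ

/-- **The physical output on the fired window.** Same hypotheses; in ORIGINAL variables, for
`s ∈ [t_c + 888 log K/M + 1/√K, 2]` (conjugated clock; physical time `T_μ(s) = -log(1 - μs)/μ`):
`|Y₄(T_μ(s)) - (1 - μs)| ≤ (1 - μs)(200K⁻¹⁰ + 4Δ/(1 - 2μ))` and `|Yᵢ(T_μ(s))| ≤ (1 - μs)·200K⁻¹⁰` (`i ≠ 4`):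
the gate has fired up to the common viscous attrition `1 - μs = e^{-μT_μ(s)}`.
[cite: Tao2016AveragedNS, Theorem 5.3, §5.5] -/
theorem firingPhase_visc_output (hμ : 0 < μ) (hμ4 : μ ≤ 1 / 4) (hd : ∀ i, μ ≤ d i ∧ d i ≤ μ + Δ)
    (hY : ∀ t ∈ Icc 0 (viscTime μ 2), HasDerivAt Y (delayCircuitWith K M ε (Y t) - d * Y t) t)
    (h0 : Y 0 = delayInit)
    (hK : 2 * 20 ^ 42 * (Nat.factorial 42 : ℝ) + 16 ≤ K) (hML : 3000 * Real.log K ≤ M)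
    (hMK : M ≤ K ^ 10) (hε : 0 < ε) (hεle : ε ≤ exp (-(10 * M)) / K ^ 100)
    (hΔ : Δ / (1 - 2 * μ) ≤ 1 / 1000) :
    ∃ tc : ℝ, |tc - Real.sqrt 2| ≤ 24 * Real.log K / M + 20 * (Δ / (1 - 2 * μ)) ∧
      ∀ s ∈ Icc (tc + 888 * Real.log K / M + 1 / Real.sqrt K) 2,
        |Y (viscTime μ s) 4 - (1 - μ * s)| ≤ (1 - μ * s) * (200 / K ^ 10 + 4 * (Δ / (1 - 2 * μ))) ∧
          ∀ i : Fin 5, i ≠ 4 → |Y (viscTime μ s) i| ≤ (1 - μ * s) * (200 / K ^ 10) := by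
  obtain ⟨tc, htc, -, hlate⟩ := firingPhase_visc hμ hμ4 hd hY h0 hK hML hMK hε hεle hΔ
  refine ⟨tc, htc, fun s hs => ?_⟩
  have hs0 : 0 ≤ s := by
    have hB : (0:ℝ) ≤ 2 * 20 ^ 42 * (Nat.factorial 42 : ℝ) := by positivity
    have hK0 : 0 < K := by linarith
    have hlog : 0 ≤ Real.log K := Real.log_nonneg (by linarith)
    have hM0 : 0 < M := by
      have : (2:ℝ) ≤ Real.log K := by
        have h16 : (16:ℝ) ≤ K := by linarith
        have := Real.log_le_log (by norm_num) h16
        have h2 : (2:ℝ) ≤ Real.log 16 := by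
          rw [show (16:ℝ) = 2 ^ 4 by norm_num, Real.log_pow]
          have := Real.log_two_gt_d9; push_cast; nlinarith
        linarith
      nlinarith
    have h1 : 0 ≤ 888 * Real.log K / M := by positivity
    have h2 : 0 ≤ 1 / Real.sqrt K := by positivity
    have h3 : 0 ≤ tc := by
      have h14 : (7:ℝ) / 5 < Real.sqrt 2 := Thm53.sqrt_two_gt
      have hx : 24 * Real.log K / M + 20 * (Δ / (1 - 2 * μ)) ≤ 24 * Real.log K / M + 1 := by
        nlinarith
      have hLM : 24 * Real.log K / M ≤ 24 / 3000 := by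
        rw [div_le_div_iff₀ hM0 (by norm_num)]; nlinarith
      have := (abs_le.1 htc).1
      linarith
    linarith [hs.1]
  have hμs : μ * s < 1 := by nlinarith [hs.2, hμ]
  have hq0 : 0 < 1 - μ * s := by linarith
  obtain ⟨h4, hi⟩ := hlate s hs
  have hY4 : ∀ i, Y (viscTime μ s) i = (1 - μ * s) * ((fun r => (1 - μ * r)⁻¹ • Y (viscTime μ r)) s i) := by
    intro i
    have := congrFun (unconj (μ := μ) hμs Y) i
    simpa only [Pi.smul_apply, smul_eq_mul] using this
  refine ⟨?_, fun i hi4 => ?_⟩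
  · rw [hY4 4, show (1 - μ * s) * ((fun r => (1 - μ * r)⁻¹ • Y (viscTime μ r)) s 4) - (1 - μ * s)
        = (1 - μ * s) * (((fun r => (1 - μ * r)⁻¹ • Y (viscTime μ r)) s 4) - 1) by ring,
      abs_mul, abs_of_pos hq0]
    exact mul_le_mul_of_nonneg_left h4 hq0.le
  · rw [hY4 i, abs_mul, abs_of_pos hq0]
    exact mul_le_mul_of_nonneg_left (hi i hi4) hq0.le

end ViscousGate

end DampedTransition

end Summit.NavierStokesRegularity.FluidComputer
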